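import Mathlib
import HarnessLib
import Summits.NavierStokesRegularity.NavierStokesRegularity.Theorems.UnthreadedRigidityDoorUnthreadedRigidityVirialHornWedgeEuler
import Summits.NavierStokesRegularity.NavierStokesRegularity.Theorems.UnthreadedRigidityDoorUnthreadedRigidityVirialHornWindowCoeffAnalytic
import Summits.NavierStokesRegularity.NavierStokesRegularity.Theorems.UnthreadedRigidityDoorUnthreadedRigidityThreadingJetsSlice
import Summits.NavierStokesRegularity.NavierStokesRegularity.Theorems.UnthreadedRigidityDoorWindowAnalytic

/-!
# Route `UnthreadedRigidityDoor`, item `UnthreadedRigidity` (W2, stmt-NavierStokesRegularity-27585) — LINE g11-1 «VIRIAL HORN»: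
# BRIDGE W `WindowWedgeAnalyticL` REDUCED TO THE INJECTIVITY OF THE BRACKETS

★ `windowWedgeAnalyticL_of_bracketInjective`: bridge W «WINDOW WEDGE + ANALYTICITY, degree l» follows from ONE algebraic statement about
solid harmonics — the injectivity of the brackets `{B_m, B_{m′}}` of a linearly independent family of solid harmonics of degree `l` on
coefficient arrays (`(∀ y, Σ_{m,m′} w_{mm′}{B_m,B_{m′}}(y) = 0) → w` symmetric; VIRIAL HORN card §6: «injectivity of `Y ∧ Z ↦ {Y,Z}` on
`Λ²V_l`», kit-certified for `l ≤ 7`, conjectural beyond — a HYPOTHESIS here).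
Assembly BY NAME: in a silent window the flux vanishes identically on the open time set, so at each `t ∈ S` its first time-derivative
vanishes; a classical pressure exists on a strip around `t` (`exists_isClassicalNSSolutionOn_Ioo`, g7), so by the open-window dictionary
(`ThreadingJets.deriv_threadingFlux_of_isOpen`, ns-crc-p1) the formal first jet `fluxJetOne (u t) x₀` vanishes identically; the slice
`u t = isoShellL n (cf t) B x₀` is admissible isotypic, so the SLICE WEDGE LAW (`wedgeVanishesL_of_fluxJetOne_eq_zero`: (F1) isotypic
order-one law + Euler step) gives `WedgeVanishesL n (cf t)`; the analyticity conjunct is W₂ (`windowWedgeAnalyticL_of_wedgeLaw`, p705805).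

HONEST LABEL: a CONDITIONAL assembly on a RUNG line about HYPOTHETICAL isotypic windows; the injectivity is NOT proved here; bridge W as
typed, `UnthreadedRigidity` (27585), W2 and NS regularity remain OPEN; nothing here is a statement about actual blow-up or regularity.
`--supports stmt-NavierStokesRegularity-27585` (helper); ns-crc-p2 g8. [folklore]
-/

-- the summit and its single sub-problem share the name (CONVENTIONS §1)
set_option linter.dupNamespace false

namespace Summit.NavierStokesRegularity.NavierStokesRegularity.Theorems.UnthreadedRigidity.VirialHorn

open scoped Topology
open Filter Set Function
open Summit.NavierStokesRegularity.NavierStokesRegularity.Theorems.UnthreadedRigidity.ProfileHorn (E3 threadingFlux)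
open Literature.Analysis.FluidPDE

/-- FIRST-JET SILENCE IN A WINDOW: for a continuous, divergence-free, Oseen-mild, locally bounded field on an open time set whose
threading flux about `x₀` vanishes identically there, the formal first jet `fluxJetOne (u t) x₀` vanishes identically at every `t ∈ S`
(classical pressure on a strip, g7's `exists_isClassicalNSSolutionOn_Ioo`; open-window dictionary, ns-crc-p1's `deriv_threadingFlux_of_isOpen`). -/
theorem fluxJetOne_eq_zero_of_unthreaded_window {S : Set ℝ} (hS : IsOpen S) {u : ℝ → E3 → E3} {x₀ : E3}
    (hcont : ContinuousOn (Function.uncurry u) (S ×ˢ Set.univ))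
    (hdiv : ∀ t ∈ S, VectorCalculus.IsDivFree (u t))
    (hmild : ∀ s ∈ S, ∀ t ∈ S, s < t → ∀ x, u t x =
        Literature.Analysis.UnboundedOperators.heatExtension (u s) (t - s) x - oseenDuhamel 1 s u u t x)
    (hbdd : ∀ τ ∈ S, ∃ B : ℝ, ∀ t ∈ S, t ≤ τ → ∀ x, ‖u t x‖ ≤ B)
    (hunth : ∀ t ∈ S, ∀ x, inner ℝ (curl (u t) x) (x - x₀) = 0) {t : ℝ} (ht : t ∈ S) (x : E3) :
    ThreadingJets.fluxJetOne (u t) x₀ x = 0 := by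
  obtain ⟨s, T₂, hst, htT, hJS, p, hcl⟩ := exists_isClassicalNSSolutionOn_Ioo hS hcont hdiv hmild hbdd ht
  have htJ : t ∈ Ioo s T₂ := ⟨hst, htT⟩
  have hflux : (fun τ => threadingFlux u x₀ τ x) =ᶠ[𝓝 t] fun _ => (0 : ℝ) := by
    filter_upwards [hS.mem_nhds ht] with τ hτ
    exact hunth τ hτ x
  have hder : deriv (fun τ => threadingFlux u x₀ τ x) t = 0 := by
    rw [hflux.deriv_eq, deriv_const]
  unfold ThreadingJets.fluxJetOne
  rw [← ThreadingJets.deriv_threadingFlux_of_isOpen hcl isOpen_Ioo htJ x₀ x]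
  exact hder

/-- ★ BRIDGE W FROM BRACKET INJECTIVITY: if for every `l ≥ 1` and every linearly independent family `B` of solid harmonics of degree `l`
the brackets `{B_m, B_{m′}}` are injective on coefficient arrays, then `WindowWedgeAnalyticL` holds
(first-jet silence in the window + the slice wedge law + W₂). -/
theorem windowWedgeAnalyticL_of_bracketInjective
    (hinj : ∀ (l n : ℕ) (B : Fin n → E3 → ℝ), 1 ≤ l → (∀ m, IsSolidHarmonic l (B m)) → LinearIndependent ℝ B →
      ∀ w : Fin n → Fin n → ℝ, (∀ y : E3, ∑ m, ∑ m', w m m' * pbr (B m) (B m') y = 0) → ∀ m m', w m m' = w m' m) :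
    WindowWedgeAnalyticL := by
  refine windowWedgeAnalyticL_of_wedgeLaw ?_
  intro l n S hl hS u x₀ hcont hdiv hmild hbdd hunth B cf hB hslice t ht
  obtain ⟨hadm, hu⟩ := hslice t ht
  have h0 : ∀ x : E3, ThreadingJets.fluxJetOne (isoShellL n (cf t) B x₀) x₀ x = 0 := fun x => by
    rw [← hu]
    exact fluxJetOne_eq_zero_of_unthreaded_window hS hcont hdiv hmild hbdd hunth ht x
  exact wedgeVanishesL_of_fluxJetOne_eq_zero hl hadm x₀ (hinj l n B hl hadm.1 hB) h0

end Summit.NavierStokesRegularity.NavierStokesRegularity.Theorems.UnthreadedRigidity.VirialHorn
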